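import Summits.BirchSwinnertonDyer.BirchSwinnertonDyer.Theorems.AdditiveBranchIMCGordTwoRankOneOffCaseOne
import Summits.BirchSwinnertonDyer.BirchSwinnertonDyer.Theorems.AdditiveBranchIMCGordTwoRankOneOddBranch
import Summits.BirchSwinnertonDyer.Rank1Residual.Additive.TwistedBranchPAdicGrossZagierEndStateThree
import HarnessLib

/-!
# Route `AdditiveBranchIMC` (rung K1), crux `GordTwoRankOne` (item 19358): the `p = 3` rows and the
# off-Case-1 CLASS FORM at EVERY odd `p` (cell `bsd-addord`, seat `bsd-addord-k1-c3`, D-0074 row B2;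
# `--supports stmt-BirchSwinnertonDyer-19358 --as helper`; siblings `…GordTwoRankOneOffCaseOne.lean` (even
# branch, `p ≡ 1 (mod 4)`) and `…GordTwoRankOneOddBranch.lean` (odd branch, `p ≡ 3 (mod 4)`, `p ≥ 7`))

HONEST FRAMING. THEOREMS ONLY: no definition, no named fact, no `sorry`, nothing booked; BSD is not proved by
any of this; the crux stays OPEN at class level — on a cyclotomic road it needs the Λ-adic LOWER containment
`char_Λ X(E/ℚ_∞) ⊆ (𝓛_p)` on the `ω^{(p−1)/2}`-branch off the Greenberg–Vatsal Case-1 rows (NOT in print: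
Skinner–Urban 2014 Cor. 3.6.3 / Thm. 3.6.4 need a `p`-ORDINARY eigenform with `p ∤ N_f`, and `f_E = f_V ⊗
ω^{(p−1)/2}` has `a_p = 0`; Wan 2015 needs `p` unramified in `ℚ(√p)`; Burungale–Skinner–Tian–Wan 2024 is PRE)
and `p`-adic height non-degeneracy (Schneider; here the per-pair certificate `A′ ≠ 0`).

* §1 `p = 3` (every (G-ord) additive row at `3` has `e = 2`: `semistabilityIndex_eq_two_of_typeG_three`):
  `exists_datum_identity_three_of_facts` (datum with Delbourgo 2002 (B) + the MINUS-branch identity at any good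
  twist model `C • V^{(−3)} = W`, from lit's fact (B) `hCyc` — its `p = 3` printed hypotheses, third disjunct —
  + `hArt` + `h73` + `hWald` + modularity + GZK, via gz's odd kernel chain p416794 / p417447);
  `cellGordTwo_missingLowerBoundAt_rankOne_three_of_facts_of_chiBranchLowerOdd_of_branchCoeffOneNeZero`
  (∀ `N10.CellGordTwo W 3` row, non-CM, NON-ANOMALOUS (`Delbourgo2002.ReductionNonAnomalous W 3` — the
  hna-free (B♮) currency is printed for `p ≥ 5` only), `r_an = 1`: `MissingLowerBoundAt W 3` from the
  published facts + Delbourgo 2002 at `p = 3` (`hDel3`) + per-pair `ChiBranchLowerDivisibilityOddAt W 3` +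
  `BranchCoeffOneNeZeroAt W 3`); the X4♯ ∩ surj(3) `BSD(E,3)` twin.
* §2 **`gordTwoRankOne_offCaseOne_of_facts_of_chiBranchLower_of_branchCoeffOneNeZero`** — the seat fragment's
  object at EVERY odd `p`: published facts → [Λ-adic inputs displayed class-wide on the off-Case-1 slice:
  PLUS branch at `p ≡ 1 (mod 4)`, MINUS branch at `p ≡ 3 (mod 4)`] → ∀ `W p`, `r_an = 1 → N10.CellGordTwo W p →
  ¬HasCaseOneMember W p → ¬CM → (p = 3 → non-anomalous) → BranchCoeffOneNeZeroAt W p → MissingLowerBoundAt W p`.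
  The registered stub `stub_offCaseOne` is this with the Λ-adic inputs, `¬CM`, the `p = 3` anomalous rows
  and the certificate discharged (H3: the certificate = Schneider at the pair, rider I1 — not attacked).

References: [Disegni2017] Thm. A, B; [Delbourgo2002] Thm. (A), (B), Hypothesis p. 39, p. 67 (iv), p. 69;
[Mazur1972Towers] Cor. 5.15; [GrossZagier1986] I.(7.3); [Kato2004Asterisque] Thm. 17.4 (3);
[MazurTateTeitelbaum1986Invent] §I.13–14; [SkinnerUrban2014] Cor. 3.6.3, Thm. 3.6.4 (pp. 42–43; shape only);
[Miller2011LMS] Def. 1.1; cell TARGET.md E39, planner/D0074-bsd-addord-seats.md row B2.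
-/

set_option autoImplicit false
set_option linter.dupNamespace false

noncomputable section

open scoped Classical MatrixGroups ModularForm NumberField

open CongruenceSubgroup WeierstrassCurve NumberField IsDedekindDomain Field
  Literature.NumberTheory.EllipticCurves Literature.NumberTheory.EllipticCurves.ModularForms
  Literature.NumberTheory.EllipticCurves.GreenbergVatsal2000
  Literature.NumberTheory.EllipticCurves.Rank1Residual
  Literature.NumberTheory.EllipticCurves.Rank1Residual.Typed
  Literature.NumberTheory.EllipticCurves.Delbourgo2002
  Literature.NumberTheory.EllipticCurves.Disegni2017
  Literature.NumberTheory.GaloisRepresentations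
  Summit.BirchSwinnertonDyer.Rank1Residual.AdditivePotMult
  Summit.BirchSwinnertonDyer.Rank1Residual.Additive

namespace Summit.BirchSwinnertonDyer.BirchSwinnertonDyer.Theorems.AdditiveBranchIMCGordTwoRankOne

/-! ### §1 `p = 3`: the (G-ord) additive rows at `3` (Gord3), rank one -/

section Three

variable {W : WeierstrassCurve ℚ} [W.IsElliptic] [W.IsGloballyMinimal]

/-- **The MINUS-branch identity at a given triple, `p = 3`, from published facts.** `W` globally minimal
without CM, ADDITIVE and (G)-ordinary at `3`, `r_an(W) = 1`; ANY good ordinary twist model `C • V^{(−3)} = W`,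
newform `f`, `ϖ·|Ω⁻_V| = Ω⁻_f`: a height datum `Dh` with Delbourgo 2002 Thm. (B) (`LeadingTermClauses`) and
`u ∈ ℤ_3^×`, `q ∈ ℚ` with `L′(E,1) = q·Ω_E·Reg_∞(E)` and `ϖ·[T¹]L_3⁻(f, α_V, ω)·log_3 γ = u·q·Reg_3(E,Dh)`.
lit's fact (B) `hCyc` is applied under its `p = 3` printed hypotheses (third disjunct: (G) + a good ordinary
quadratic twist, `TypeGOrd.exists_goodOrd_twist_model_three`); chain = gz's `DisegniLineEndStateThree`
verbatim, its X3 hypothesis being idle. [cite: Disegni2017, Theorem A (arXiv v3 PDF pp. 7–8), Theorem B (PDF p. 9)]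
[cite: Delbourgo2002, Theorem (B) (p. 40); Hypothesis (p. 39)] [cite: GrossZagier1986, Thm. I.(7.3)]
[cite: Darmon2004, §3.9, proof of Thm. 3.22] [cite: MazurTateTeitelbaum1986Invent, §I.13] -/
theorem exists_datum_identity_three_of_facts [hp : Fact (Nat.Prime 3)]
    (hCyc : delbourgoDatum_cycLineGrossZagier)
    (hArt : rankinSelbergEulerProductHecke_baseChangeDirichlet_eq) (h73 : GrossZagier1986_thm_I_7_3)
    (hWald : waldspurger_exists_heegnerField_twist_ne_zero)
    (hmod : hasEntireLFunction_rat) (hmodD : nonempty_modularParametrizationData)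
    (hmodN : exists_isNewformOf) (hGZK : rank_eq_analyticRank_of_analyticRank_le_one)
    (haddv : Addv W 3) (hG : TypeGOrd W 3) (hcm : ¬ W.HasCM) (hr : W.analyticRank = 1)
    (V : WeierstrassCurve ℚ) [V.IsElliptic] [V.IsGloballyMinimal] (C : VariableChange ℚ)
    (hV : GoodOrd V 3) (hC : C • V.quadraticTwist ((-1 : ℚ) ^ ((3 : ℕ) / 2) * (3 : ℕ)) = W)
    {N : ℕ} [NeZero N] {f : CuspForm (Gamma0 N) 2} (hf : IsNewformOf V f)
    (ϖ : ℚ) (hϖ : (ϖ : ℝ) * V.imaginaryPeriodRat = minusPeriod f) :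
    ∃ Dh : PAdicHeightData W 3, LeadingTermClauses W 3 Dh ∧
      ∃ (u : ℤ_[3]ˣ) (q : ℚ),
        W.leadingLCoeff = (q : ℂ) * (W.realPeriodRat : ℂ) * (W.regulator : ℂ) ∧
        (ϖ : ℚ_[3]) *
            PowerSeries.coeff 1 (padicLFunctionMinusBranch f ((unitRoot V 3 : ℤ_[3]) : ℚ_[3]) ((3 : ℕ) / 2)) *
            padicLog 3 (cyclotomicGenerator 3) =
          ((u : ℤ_[3]) : ℚ_[3]) * (q : ℚ_[3]) * padicRegulator Dh := by
  -- adapted from gz's `ClassX3Gord.bsdp_three_rankOne_of_facts_of_cycLineFact_of_branchCoeffOneNeZero`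
  have hpP : (3 : ℕ).Prime := hp.out
  have hp4 : (3 : ℕ) % 4 = 3 := by norm_num
  have hp2 : (3 : ℕ) ≠ 2 := by norm_num
  have hps : ((-1 : ℚ) ^ ((3 : ℕ) / 2) * ((3 : ℕ) : ℚ)) = -((3 : ℕ) : ℚ) := by norm_num
  have hC' : C • V.quadraticTwist (-((3 : ℕ) : ℚ)) = W := by rw [← hps]; exact hC
  have hVW : ∃ C : VariableChange ℚ, C • V.quadraticTwist (-((3 : ℕ) : ℚ)) = W := ⟨C, hC'⟩
  have hordin : IsOrdinaryAt V 3 := ⟨hV.1, hV.2⟩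
  haveI : NeZero (W.conductorNorm ℤ) := ⟨(W.conductorNorm_pos_holds).ne'⟩
  obtain ⟨DmW⟩ := hmodD W
  -- the Heegner field with `L(E^{(d_K)}, 1) ≠ 0` (Waldspurger)
  have hroot : W.rootNumber = -1 := by
    rcases rootNumber_eq_one_or_eq_neg_one W with h1 | h1
    · exfalso
      have hev1 : Even W.analyticRank :=
        (even_analyticRank_iff_rootNumber_eq_one_of_exists_isNewformOf W hmodN).mpr h1
      rw [hr] at hev1
      exact Nat.not_even_one hev1
    · exact h1
  obtain ⟨K, _, _, hK, -, hHeeg, hLd⟩ := hWald W hroot 0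
  have h2 : Module.finrank ℚ K = 2 := hK.1
  haveI : IsGalois ℚ K := isGalois_of_finrank_eq_two K h2
  have hdq : (NumberField.discr K : ℚ) ≠ 0 := by exact_mod_cast NumberField.discr_ne_zero K
  -- the Kronecker character and the twist data
  obtain ⟨κ, hκ, hκ2, hκall⟩ := exists_kroneckerChar_twistCoeff K h2
  obtain ⟨hpd, hκW, V', iV', iVm', N', _, f', hfV', hV', hap, hordV'⟩ :=
    exists_twist_newform_neg K hmodD hmodN hp4 h2 κ hκ hκall hHeeg haddv V hVW hV hf
  have hpdN : Nat.Coprime 3 (NumberField.discr K).natAbs :=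
    (Nat.Prime.coprime_iff_not_dvd hpP).mpr fun h ↦ hpd (Int.natCast_dvd.mpr h)
  have hS' : legendreMinusSymbolSum f' 3 ≠ 0 :=
    legendreMinusSymbolSum_ne_zero_of_twist K hmod hp4 κ hκW haddv V hVW hf hfV'.1
      hfV'.coeffField_eq_bot hV' hLd
  have hrd : (W.quadraticTwist (NumberField.discr K : ℚ)).mordellWeilRank = 0 := by
    haveI := W.isElliptic_quadraticTwist hdq
    have h0 : (W.quadraticTwist (NumberField.discr K : ℚ)).analyticRank = 0 :=
      (analyticRank_eq_zero_iff_holds (hmod _)).mpr hLd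
    rw [(hGZK _ (by rw [h0]; exact zero_le_one)).1, h0]
  -- the datum: lit's conjoined fact (B), `p = 3` printed hypotheses (third disjunct)
  obtain ⟨ι⟩ := PadicAlgCl.nonempty_ringEquiv_complex (p := 3)
  have hpstar : ((pStar 3 : ℤ) : ℚ) = -((3 : ℕ) : ℚ) := by rw [pStar]; norm_num
  have hCps : C • V.quadraticTwist (pStar 3 : ℚ) = W := by rw [hpstar]; exact hC'
  obtain ⟨Dh, DhK, hres, hB, hGZc⟩ := hCyc.exists_datum ι hp2 hcm haddv hr
    (Or.inr (Or.inr ⟨rfl, hG, hG.exists_goodOrd_twist_model_three haddv⟩))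
    hCps (Or.inl ⟨hV.1, hordin, rfl⟩) DmW.isNewformOf hK hHeeg
  -- STEP C⁻(2): the identity at `(V, f, ϖ)`
  obtain ⟨u, q, hlead, hpgz⟩ := branchPAdicGrossZagier_identity_of_cycLine_odd ι K hp4 hArt h73 hmod hGZK
    h2 κ hκ hκ2 hpdN hrd haddv hr V V' C hC' hV hordV' hap hf DmW.isNewformOf hfV' hV' hS' ϖ hϖ hres hGZc
  exact ⟨Dh, hB, u, q, hlead, hpgz⟩

/-- **The lower half at a given good twist model from the identity, `p = 3`** (core; NON-ANOMALOUS rows —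
Delbourgo's factor `ℓ_3(E) = 1`): Schneider for `Dh` (`…_odd`), the rank-one lower factorisation
(`cycLowerBoundAt_of_chiBranchLowerOdd_of_identity`), Delbourgo 2002 (A) at `3`
(`TypeGOrd.isTorsion_three_of_delbourgo2002`), `missingLowerBoundAt_of_cycLowerBound`.
[cite: Delbourgo2002, Theorem (A), (B) (p. 40), ℓ_p(E) (p. 39)] [cite: MazurTateTeitelbaum1986Invent, §I.13]
[cite: Miller2011LMS, Def. 1.1] -/
theorem missingLowerBoundAt_rankOne_three_of_model_of_identity_of_chiBranchLowerOdd_of_branchCoeffOneNeZero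
    [hp : Fact (Nat.Prime 3)] (hDel3 : Delbourgo2002.mainTheorem_three)
    (hmod : hasEntireLFunction_rat) (hGZK : rank_eq_analyticRank_of_analyticRank_le_one)
    (haddv : Addv W 3) (hG : TypeGOrd W 3) (hcm : ¬ W.HasCM) (hna : ReductionNonAnomalous W 3)
    (hr : W.analyticRank = 1)
    (V : WeierstrassCurve ℚ) [V.IsElliptic] [V.IsGloballyMinimal] (C : VariableChange ℚ)
    (hV : GoodOrd V 3) (hC : C • V.quadraticTwist ((-1 : ℚ) ^ ((3 : ℕ) / 2) * (3 : ℕ)) = W)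
    {N : ℕ} [NeZero N] (f : CuspForm (Gamma0 N) 2) (hf : IsNewformOf V f)
    (ϖ : ℚ) (hϖ : (ϖ : ℝ) * V.imaginaryPeriodRat = minusPeriod f)
    {Dh : PAdicHeightData W 3} (hB : LeadingTermClauses W 3 Dh) {u : ℤ_[3]ˣ} {q : ℚ}
    (hlead : W.leadingLCoeff = (q : ℂ) * (W.realPeriodRat : ℂ) * (W.regulator : ℂ))
    (hpgz : (ϖ : ℚ_[3]) *
        PowerSeries.coeff 1 (padicLFunctionMinusBranch f ((unitRoot V 3 : ℤ_[3]) : ℚ_[3]) ((3 : ℕ) / 2)) *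
        padicLog 3 (cyclotomicGenerator 3) = ((u : ℤ_[3]) : ℚ_[3]) * (q : ℚ_[3]) * padicRegulator Dh)
    (hdiv : ChiBranchLowerDivisibilityOddAt W 3) (hne : BranchCoeffOneNeZeroAt W 3) :
    MissingLowerBoundAt W 3 := by
  have hp4 : (3 : ℕ) % 4 = 3 := by norm_num
  have hps : ((-1 : ℚ) ^ ((3 : ℕ) / 2) * ((3 : ℕ) : ℚ)) = -((3 : ℕ) : ℚ) := by norm_num
  have hVW : ∃ C : VariableChange ℚ, C • V.quadraticTwist (-((3 : ℕ) : ℚ)) = W :=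
    ⟨C, by rw [← hps]; exact hC⟩
  have hSch : SchneiderConjecture Dh :=
    schneiderConjecture_of_identity_of_branchCoeffOneNeZero_odd hp4 hne V C hC ⟨hV.1, hV.2⟩ f hf ϖ hϖ hpgz
  have hlow : CycLowerBoundAt W 3 Dh :=
    cycLowerBoundAt_of_chiBranchLowerOdd_of_identity W 3 hmod hGZK haddv hr hp4 V hVW hV hf ϖ hϖ hdiv hlead
      hpgz
  exact missingLowerBoundAt_of_cycLowerBound W 3 hB hSch
    (fun κ' γ hκ' hγ D ↦ TypeGOrd.isTorsion_three_of_delbourgo2002 hDel3 hG haddv hcm hκ' hγ D) hGZK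
    (by rw [hr]) hna hlow

/-- **Cell (G-ord, `e = 2`) at `p = 3` (= all (G)-ordinary additive rows at `3`, Gord3), `E` non-CM,
NON-ANOMALOUS, `r_an(E) = 1`, ANY residual image: the LOWER half `ord_3 #Ш(E)_an ≤ ord_3 #Ш(E)` from PUBLISHED
named facts (`hCyc` `hArt` `h73` `hWald` `hDel3` modularity GZK) + TWO typed per-pair inputs** — (L)
`ChiBranchLowerDivisibilityOddAt W 3` (NOT in print off the Case-1 rows; on them it is the twist seat's
`X3Branch.chiBranchLowerDivisibilityOddAt_of_facts_of_lifting`) and (S′) `BranchCoeffOneNeZeroAt W 3`.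
[cite: Delbourgo2002, Theorem (A), (B) (p. 40), ℓ_p(E) (p. 39)] [cite: Disegni2017, Theorem A/B (arXiv v3 PDF 7–9)]
[cite: MazurTateTeitelbaum1986Invent, §I.13] [cite: Miller2011LMS, Def. 1.1] -/
theorem cellGordTwo_missingLowerBoundAt_rankOne_three_of_facts_of_chiBranchLowerOdd_of_branchCoeffOneNeZero
    [hp : Fact (Nat.Prime 3)] (hCyc : delbourgoDatum_cycLineGrossZagier)
    (hArt : rankinSelbergEulerProductHecke_baseChangeDirichlet_eq) (h73 : GrossZagier1986_thm_I_7_3)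
    (hWald : waldspurger_exists_heegnerField_twist_ne_zero) (hDel3 : Delbourgo2002.mainTheorem_three)
    (hmod : hasEntireLFunction_rat) (hmodD : nonempty_modularParametrizationData)
    (hmodN : exists_isNewformOf) (hGZK : rank_eq_analyticRank_of_analyticRank_le_one)
    (hc : N10.CellGordTwo W 3) (hcm : ¬ W.HasCM) (hna : ReductionNonAnomalous W 3)
    (hr : W.analyticRank = 1)
    (hdiv : ChiBranchLowerDivisibilityOddAt W 3) (hne : BranchCoeffOneNeZeroAt W 3) :
    MissingLowerBoundAt W 3 := by
  obtain ⟨hp2, haddv, hG, he⟩ := hc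
  obtain ⟨V, iV, iVm, C, hV, hC⟩ := TypeGOrd.exists_goodOrd_pStar_twist_model W 3 hp2 hG haddv he
  haveI : NeZero (V.conductorNorm ℤ) := ⟨(V.conductorNorm_pos_holds).ne'⟩
  obtain ⟨Dm⟩ := hmodD V
  obtain ⟨ϖ, -, hϖ⟩ := exists_rat_mul_imaginaryPeriodRat_eq_minusPeriod Dm
  obtain ⟨Dh, hB, u, q, hlead, hpgz⟩ := exists_datum_identity_three_of_facts hCyc hArt h73 hWald hmod hmodD
    hmodN hGZK haddv hG hcm hr V C hV hC Dm.isNewformOf ϖ hϖ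
  exact missingLowerBoundAt_rankOne_three_of_model_of_identity_of_chiBranchLowerOdd_of_branchCoeffOneNeZero
    hDel3 hmod hGZK haddv hG hcm hna hr V C hV hC Dm.f Dm.isNewformOf ϖ hϖ hB hlead hpgz hdiv hne

/-- **X4♯(G-ord) at `p = 3` ∩ {`ρ̄_{E,3}` onto}, `E` non-CM, non-anomalous, `r_an(E) = 1`: `BSD(E,3)` from the
per-pair Λ-adic MINUS-branch input `ChiBranchLowerDivisibilityOddAt W 3` (DISPLAYED, NOT in print), PUBLISHED
named facts (`hCyc` `hArt` `h73` `hWald` `hDel3`, Kato's half `hK`, modularity, GZK) and `BranchCoeffOneNeZeroAt W 3`.**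
Lower = §1 core; upper = `classX4Gord_missingUpperBoundAt_rankOne_of_katoHalf_of_identity_odd` (`p = 3`
allowed). [cite: Delbourgo2002, Theorem (A), (B) (p. 40)] [cite: Kato2004Asterisque, Thm. 17.4 (3) (p. 273)]
[cite: Wuthrich2014, Lemma 20 (p. 399)] [cite: Disegni2017, Theorem A/B (arXiv v3 PDF 7–9)] [cite: Miller2011LMS, Def. 1.1] -/
theorem classX4Gord_bsdp_rankOne_three_of_chiBranchLowerOdd_of_cycLineFact_of_katoHalf
    [hp : Fact (Nat.Prime 3)] (hCyc : delbourgoDatum_cycLineGrossZagier)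
    (hArt : rankinSelbergEulerProductHecke_baseChangeDirichlet_eq) (h73 : GrossZagier1986_thm_I_7_3)
    (hWald : waldspurger_exists_heegnerField_twist_ne_zero) (hDel3 : Delbourgo2002.mainTheorem_three)
    (hK : Wuthrich2014.kato_halfEigenCharIdeal_dvd_cyclotomicPrime_of_surjective)
    (hmod : hasEntireLFunction_rat) (hmodD : nonempty_modularParametrizationData)
    (hmodN : exists_isNewformOf) (hGZK : rank_eq_analyticRank_of_analyticRank_le_one)
    (hX : ClassX4Gord W 3) (hcm : ¬ W.HasCM) (hna : ReductionNonAnomalous W 3) (hsurj : Surj W 3)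
    (hr : W.analyticRank = 1)
    (hdiv : ChiBranchLowerDivisibilityOddAt W 3) (hne : BranchCoeffOneNeZeroAt W 3) : BSDp W 3 := by
  have hp4 : (3 : ℕ) % 4 = 3 := by norm_num
  have he : semistabilityIndex W 3 = 2 :=
    semistabilityIndex_eq_two_of_typeG_three W hX.typeGOrd.typeG hX.addv.2
  obtain ⟨V, iV, iVm, C, hV, hC⟩ := hX.exists_goodOrd_pStar_twist_model W 3 he
  have hordin : IsOrdinaryAt V 3 := ⟨hV.1, hV.2⟩
  haveI : NeZero (V.conductorNorm ℤ) := ⟨(V.conductorNorm_pos_holds).ne'⟩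
  obtain ⟨Dm⟩ := hmodD V
  obtain ⟨ϖ, -, hϖ⟩ := exists_rat_mul_imaginaryPeriodRat_eq_minusPeriod Dm
  obtain ⟨Dh, hB, u, q, hlead, hpgz⟩ := exists_datum_identity_three_of_facts hCyc hArt h73 hWald hmod hmodD
    hmodN hGZK hX.addv.2 hX.typeGOrd hcm hr V C hV hC Dm.isNewformOf ϖ hϖ
  have hl : MissingLowerBoundAt W 3 :=
    missingLowerBoundAt_rankOne_three_of_model_of_identity_of_chiBranchLowerOdd_of_branchCoeffOneNeZero
      hDel3 hmod hGZK hX.addv.2 hX.typeGOrd hcm hna hr V C hV hC Dm.f Dm.isNewformOf ϖ hϖ hB hlead hpgz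
      hdiv hne
  have hSch : SchneiderConjecture Dh :=
    schneiderConjecture_of_identity_of_branchCoeffOneNeZero_odd hp4 hne V C hC hordin Dm.f Dm.isNewformOf ϖ
      hϖ hpgz
  have hu : MissingUpperBoundAt W 3 :=
    classX4Gord_missingUpperBoundAt_rankOne_of_katoHalf_of_identity_odd hK hGZK hmod hX hp4 hsurj hr hB hSch
      V hV C hC Dm.isNewformOf ϖ hϖ hlead hpgz
  exact bsdp_of_missingPPartAt W 3 hGZK (by rw [hr]) (missingPPartAt_of_lower_of_upper W 3 hl hu)

end Three

/-! ### §2 EVERY odd `p`: the off-Case-1 class form of crux `GordTwoRankOne` (seat fragment D0074 row B2 (a)) -/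

/-- **Crux `GordTwoRankOne` OFF the Case-1 rows, every odd `p`, non-CM: the class form MODULO the displayed
Λ-adic inputs and the per-pair certificate.** GRANTED the Λ-adic branch lower containment on the slice {cell
(G-ord, `e = 2`), NO Case-1 member in the isogeny class} — PLUS branch `hΛ` at `p ≡ 1 (mod 4)`, MINUS branch
`hΛ'` at `p ≡ 3 (mod 4)` (`p = 3` included) — i.e. the rank-free Λ-adic layer of crux `GordTwoRankZeroOffCaseOne`
(Skinner–Urban-type Eisenstein congruences for `f_V ⊗ ω^{(p−1)/2}` on the irreducible rows, Greenberg's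
μ-territory on the reducible no-Case-1 rows; NOT in print, NOT asserted), every such row of analytic rank `1`
with `A′ ≠ 0` (`BranchCoeffOneNeZeroAt W p`, certified per pair) — and, at `p = 3`, non-anomalous reduction —
satisfies `ord_p #Ш(E)_an ≤ ord_p #Ш(E)`. Published binders: Mazur 1972 Cor. 5.15, lit's fact (B) `hCyc`,
`hArt`, `h73`, `hWald`, Delbourgo 2002 (`hDel` at `p ≥ 5`, `hDel3` at `p = 3`), modularity, GZK. Dispatch on
`p = 3` / `p % 4 = 1` / `p % 4 = 3 ∧ p ≥ 5` to the three `cellGordTwo_…` theorems.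
[cite: Delbourgo2002, Theorem (A), (B) (p. 40), p. 67 (iv), p. 69] [cite: Mazur1972Towers, Cor. 5.15]
[cite: SkinnerUrban2014, Cor. 3.6.3, Thm. 3.6.4 (pp. 42–43) (shape only; nothing asserted)] [cite: Miller2011LMS, Def. 1.1] -/
theorem gordTwoRankOne_offCaseOne_of_facts_of_chiBranchLower_of_branchCoeffOneNeZero
    (hMaz : Mazur1972.cor515_universalNormIndex) (hCyc : delbourgoDatum_cycLineGrossZagier)
    (hArt : rankinSelbergEulerProductHecke_baseChangeDirichlet_eq) (h73 : GrossZagier1986_thm_I_7_3)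
    (hWald : waldspurger_exists_heegnerField_twist_ne_zero) (hDel : Delbourgo2002.mainTheorem)
    (hDel3 : Delbourgo2002.mainTheorem_three)
    (hmod : hasEntireLFunction_rat) (hmodD : nonempty_modularParametrizationData)
    (hmodN : exists_isNewformOf) (hGZK : rank_eq_analyticRank_of_analyticRank_le_one)
    (hΛ : ∀ (W : WeierstrassCurve ℚ) [W.IsElliptic] [W.IsGloballyMinimal] (p : ℕ) [Fact p.Prime],
      N10.CellGordTwo W p → ¬ HasCaseOneMember W p → p % 4 = 1 → ChiBranchLowerDivisibilityAt W p)
    (hΛ' : ∀ (W : WeierstrassCurve ℚ) [W.IsElliptic] [W.IsGloballyMinimal] (p : ℕ) [Fact p.Prime],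
      N10.CellGordTwo W p → ¬ HasCaseOneMember W p → p % 4 = 3 → ChiBranchLowerDivisibilityOddAt W p) :
    ∀ (W : WeierstrassCurve ℚ) [W.IsElliptic] [W.IsGloballyMinimal] (p : ℕ) [Fact p.Prime],
      W.analyticRank = 1 → N10.CellGordTwo W p → ¬ HasCaseOneMember W p → ¬ W.HasCM →
      (p = 3 → ReductionNonAnomalous W p) → BranchCoeffOneNeZeroAt W p → MissingLowerBoundAt W p := by
  intro W _ _ p hpF hr hc hm hcm hna3 hne
  by_cases hp3 : p = 3
  · subst hp3
    exact cellGordTwo_missingLowerBoundAt_rankOne_three_of_facts_of_chiBranchLowerOdd_of_branchCoeffOneNeZero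
      hCyc hArt h73 hWald hDel3 hmod hmodD hmodN hGZK hc hcm (hna3 rfl) hr (hΛ' W 3 hc hm (by norm_num)) hne
  · have hp5 : 5 ≤ p := hpF.out.five_le_of_ne_two_of_ne_three hc.1 hp3
    have hodd : p % 4 = 1 ∨ p % 4 = 3 := by
      obtain ⟨k, hk⟩ := hpF.out.odd_of_ne_two hc.1
      omega
    rcases hodd with h1 | h3
    · exact cellGordTwo_missingLowerBoundAt_rankOne_of_facts_of_chiBranchLower_of_branchCoeffOneNeZero hMaz
        hCyc hArt h73 hWald hDel hmod hmodD hmodN hGZK hc h1 hcm hr (hΛ W p hc hm h1) hne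
    · exact cellGordTwo_missingLowerBoundAt_rankOne_odd_of_facts_of_chiBranchLowerOdd_of_branchCoeffOneNeZero
        hMaz hCyc hArt h73 hWald hDel hmod hmodD hmodN hGZK hc h3 hp5 hcm hr (hΛ' W p hc hm h3) hne

end Summit.BirchSwinnertonDyer.BirchSwinnertonDyer.Theorems.AdditiveBranchIMCGordTwoRankOne

end
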